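import Literature.Combinatorics.SimpleGraph.CharpolyEdgeDeletion
import Mathlib.Combinatorics.SimpleGraph.CycleGraph
import HarnessLib

/-!
# The characteristic polynomial of the cycle: `φ(C_n, x) = φ(P_n, x) − φ(P_{n−2}, x) − 2`
# (Godsil, *Algebraic Combinatorics*, Ch. 4 Exercise 5)

Source (held text `book:godsil2017-algebraic-combinatorics`, Ch. 4 «Walk Generating Functions»,
Exercises, p. 64): C. D. Godsil, *Algebraic Combinatorics* (Chapman & Hall 1993) [Godsil1993].

«[5] Use Lemma 1.5 to show that `φ(C_n, x) = φ(P_n, x) − φ(P_{n−2}, x) − 2`.»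

Lemma 1.5 is the edge-deletion formula
`φ(G, x) = φ(G ∖ e, x) − φ(G ∖ ij, x) − 2 φ_ij(G ∖ e, x)`, in the tree as
`CharpolyEdgeDeletion.charpoly_adjMatrix_eq_deleteEdges`. For the cycle `C_n`
(Mathlib's `SimpleGraph.cycleGraph n` on `Fin n`, `n ≥ 3`) and the edge `e = {0, n − 1}`:
`C_n ∖ e = P_n` (Mathlib's `SimpleGraph.pathGraph n`; `cycleGraph_deleteEdges_eq_pathGraph`),
`C_n ∖ {0, n − 1} ≅ P_{n−2}` (`nonempty_iso_cycleGraph_induce`), and the cofactor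
`φ_{0,n−1}(P_n, x) = adj(xI − A(P_n))_{0,n−1} = 1` (`adjugate_charmatrix_pathGraph_zero_last`:
the only `0 … n−1` path in `P_n` is `P_n` itself; computed here by expanding the determinant
along the replaced row, which leaves a triangular minor with diagonal `−1`).
Hence **`charpoly_adjMatrix_cycleGraph`**: `φ(C_{n+3}) = φ(P_{n+3}) − φ(P_{n+1}) − 2`.

With the tree's `φ(P_n)(2x) = U_n(x)` (`PendantVertexCharpoly.charpoly_adjMatrix_pathGraph_comp_two_mul_X`)
and Mathlib's `U_{n+2} = 2 T_{n+2} + U_n` this is the classical closed form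
**`φ(C_n, 2x) = 2 (T_n(x) − 1)`** (`charpoly_adjMatrix_cycleGraph_comp_two_mul_X`), whence
`φ(C_n, 2) = 0` (`2` = the valency is an eigenvalue) and `φ(C_n, −2) = 2((−1)^n − 1)`
(`−2` is an eigenvalue iff `n` is even), and the first cases `φ(C_3) = x³ − 3x − 2`,
`φ(C_4) = x⁴ − 4x²`.
-/

open Finset Matrix Polynomial SimpleGraph
open Literature.Combinatorics.SimpleGraph.PendantVertexCharpoly
open Literature.Combinatorics.SimpleGraph.CharpolyEdgeDeletion

namespace Literature.Combinatorics.SimpleGraph.CycleGraphCharpoly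

/-! ### § 1 `C_n ∖ e = P_n` and `C_n ∖ {0, n−1} ≅ P_{n−2}` -/

section Graphs

variable {n : ℕ}

/-- In `Fin (n + 3)`: `a − b = 1` iff `a = b + 1` in `ℕ`, or `(a, b) = (0, n + 2)` (wrap-around).
[folklore] -/
private theorem val_sub_eq_one_iff (a b : Fin (n + 3)) :
    (a - b).val = 1 ↔ a.val = b.val + 1 ∨ (a.val = 0 ∧ b.val = n + 2) := by
  have ha := a.isLt
  have hb := b.isLt
  rcases le_or_gt b a with h | h
  · rw [Fin.coe_sub_iff_le.2 h]
    rw [Fin.le_def] at h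
    omega
  · rw [Fin.coe_sub_iff_lt.2 h]
    rw [Fin.lt_def] at h
    omega

/-- Adjacency in the cycle `C_{n+3}` on `Fin (n + 3)` (Mathlib: `a − b = 1 ∨ b − a = 1`) in terms
of the labels `0, …, n + 2`: consecutive labels, or the closing edge `{0, n + 2}` — i.e. the cycle
`C_n` on `{0, …, n − 1}` with `i ∼ i + 1 (mod n)`.
[cite: Godsil1993, Ch. 4 Ex. 5 (the cycle `C_n`), held godsil2017 p. 64] -/
theorem cycleGraph_adj_iff (a b : Fin (n + 3)) :
    (cycleGraph (n + 3)).Adj a b ↔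
      a.val + 1 = b.val ∨ b.val + 1 = a.val ∨ (a.val = 0 ∧ b.val = n + 2) ∨
        (b.val = 0 ∧ a.val = n + 2) := by
  rw [cycleGraph_adj', val_sub_eq_one_iff, val_sub_eq_one_iff]
  omega

/-- The closing edge `e = {0, n + 2}` of `C_{n+3}` (the edge deleted in Exercise 5).
[cite: Godsil1993, Ch. 4 Ex. 5, held godsil2017 p. 64] -/
theorem cycleGraph_adj_zero_last : (cycleGraph (n + 3)).Adj 0 (Fin.last (n + 2)) := by
  rw [cycleGraph_adj_iff, Fin.val_zero, Fin.val_last]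
  omega

/-- **`C_n ∖ e = P_n`**: deleting the closing edge `{0, n + 2}` from the cycle `C_{n+3}` leaves
Mathlib's path `P_{n+3}` (edges `{i, i + 1}`). [cite: Godsil1993, Ch. 4 Ex. 5, held godsil2017 p. 64] -/
theorem cycleGraph_deleteEdges_eq_pathGraph (n : ℕ) :
    (cycleGraph (n + 3)).deleteEdges {s((0 : Fin (n + 3)), Fin.last (n + 2))} = pathGraph (n + 3) := by
  ext a b
  rw [deleteEdges_adj, cycleGraph_adj_iff, pathGraph_adj, Set.mem_singleton_iff, Sym2.eq_iff]
  have ha := a.isLt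
  have hb := b.isLt
  simp only [Fin.ext_iff, Fin.val_zero, Fin.val_last]
  omega

/-- **`C_n ∖ {0, n−1} ≅ P_{n−2}`**: deleting both ends of the closing edge from `C_{n+3}` leaves a
copy of `P_{n+1}` (relabel `a ↦ a − 1`). [cite: Godsil1993, Ch. 4 Ex. 5, held godsil2017 p. 64] -/
theorem nonempty_iso_cycleGraph_induce (n : ℕ) :
    Nonempty ((cycleGraph (n + 3)).induce {a | a ≠ 0 ∧ a ≠ Fin.last (n + 2)} ≃g
      pathGraph (n + 1)) := by
  refine ⟨{ toFun := fun a => ⟨(a.1 : ℕ) - 1, ?_⟩,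
            invFun := fun i => ⟨⟨(i : ℕ) + 1, by omega⟩, ?_⟩,
            left_inv := ?_,
            right_inv := ?_,
            map_rel_iff' := ?_ }⟩
  · have h1 : (a.1 : ℕ) ≠ n + 2 := fun h => a.2.2 (Fin.ext (by rw [h, Fin.val_last]))
    have h2 := a.1.isLt
    omega
  · have hi := i.isLt
    constructor
    · intro h
      have h' := congrArg Fin.val h
      rw [Fin.val_zero] at h'
      exact absurd h' (by simp)
    · intro h
      have h' := congrArg Fin.val h
      rw [Fin.val_last, Fin.val_mk] at h'
      omega
  · intro a
    have h0 : (a.1 : ℕ) ≠ 0 := fun h => a.2.1 (Fin.ext (by rw [h, Fin.val_zero]))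
    exact Subtype.ext (Fin.ext (by simp only; omega))
  · intro i
    exact Fin.ext (by simp)
  · intro a b
    have ha0 : (a.1 : ℕ) ≠ 0 := fun h => a.2.1 (Fin.ext (by rw [h, Fin.val_zero]))
    have ha1 : (a.1 : ℕ) ≠ n + 2 := fun h => a.2.2 (Fin.ext (by rw [h, Fin.val_last]))
    have hb0 : (b.1 : ℕ) ≠ 0 := fun h => b.2.1 (Fin.ext (by rw [h, Fin.val_zero]))
    have hb1 : (b.1 : ℕ) ≠ n + 2 := fun h => b.2.2 (Fin.ext (by rw [h, Fin.val_last]))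
    simp only [Equiv.coe_fn_mk, pathGraph_adj, comap_adj, Function.Embedding.subtype_apply,
      cycleGraph_adj_iff]
    omega

end Graphs

/-! ### § 2 The cofactor `φ_{0,n−1}(P_n, x) = 1` -/

section Cofactor

variable (R : Type*) [CommRing R]

/-- **`φ_{0,n}(P_{n+1}, x) = 1`**: the `(0, n)` entry of `adj(xI − A(P_{n+1}))` is `1` (the path
formula `φ_ij = Σ_{P ∈ 𝒫_ij} φ(G ∖ P)` has the single term `φ(∅) = 1`; here: replace row `n` of
`xI − A(P_{n+1})` by `e_0`, expand along that row, and the surviving minor — rows `0, …, n − 1`,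
columns `1, …, n` — is lower triangular with diagonal `−1`, so the cofactor is
`(−1)^n (−1)^n = 1`). [cite: Godsil1993, Ch. 4 Ex. 5 («it will probably be necessary to use
the result of Exercise 3 in Chapter 1»), held godsil2017 p. 64] -/
theorem adjugate_charmatrix_pathGraph_zero_last (n : ℕ) [DecidableRel (pathGraph (n + 1)).Adj] :
    (charmatrix ((pathGraph (n + 1)).adjMatrix R)).adjugate 0 (Fin.last n) = 1 := by
  set N := charmatrix ((pathGraph (n + 1)).adjMatrix R) with hN
  -- expand `det` of `N` with row `n` replaced by `e_0` along that row: one term survives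
  rw [adjugate_apply, det_succ_row _ (Fin.last n), Finset.sum_eq_single (0 : Fin (n + 1))
    (fun j _ hj => by rw [updateRow_self, Pi.single_apply, if_neg hj, mul_zero, zero_mul])
    (fun h => absurd (Finset.mem_univ _) h),
    updateRow_self, Pi.single_eq_same, mul_one, Fin.val_last, Fin.val_zero, add_zero,
    Fin.succAbove_last, Fin.succAbove_zero]
  have hsub : (N.updateRow (Fin.last n) (Pi.single 0 1)).submatrix Fin.castSucc Fin.succ =
      N.submatrix Fin.castSucc Fin.succ := by
    refine Matrix.ext fun a b => ?_
    rw [submatrix_apply, submatrix_apply, updateRow_ne (Fin.castSucc_lt_last a).ne]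
  rw [hsub]
  -- the remaining minor (rows `0 … n−1`, columns `1 … n`) is lower triangular, diagonal `−1`
  have htri : (N.submatrix Fin.castSucc Fin.succ).BlockTriangular OrderDual.toDual := by
    intro a b hab
    rw [OrderDual.toDual_lt_toDual, Fin.lt_def] at hab
    have hlt : a.castSucc.val + 1 < b.succ.val := by
      rw [Fin.val_castSucc, Fin.val_succ]
      omega
    have hne : a.castSucc ≠ b.succ := fun h => by
      rw [h] at hlt
      omega
    have hnadj : ¬ (pathGraph (n + 1)).Adj a.castSucc b.succ := by
      rw [pathGraph_adj]
      omega
    rw [submatrix_apply, hN, charmatrix_apply_ne _ _ _ hne, adjMatrix_apply, if_neg hnadj, map_zero,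
      neg_zero]
  have hk : ∀ k : Fin n, N.submatrix Fin.castSucc Fin.succ k k = -1 := fun k => by
    have hadj : (pathGraph (n + 1)).Adj k.castSucc k.succ := by
      rw [pathGraph_adj, Fin.val_castSucc, Fin.val_succ]
      omega
    rw [submatrix_apply, hN, charmatrix_apply_ne _ _ _ (ne_of_lt Fin.castSucc_lt_succ),
      adjMatrix_apply, if_pos hadj, map_one]
  rw [det_of_lowerTriangular _ htri]
  simp only [hk, Fin.prod_const]
  rw [← pow_add, ← two_mul, pow_mul, neg_one_sq, one_pow]

end Cofactor

/-! ### § 3 `φ(C_n) = φ(P_n) − φ(P_{n−2}) − 2` and the Chebyshev form -/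

section Main

variable (R : Type*) [CommRing R]

/-- **Godsil, Ch. 4 Exercise 5: `φ(C_n, x) = φ(P_n, x) − φ(P_{n−2}, x) − 2`** (`n ≥ 3`; here
`C_{n+3}`, `P_{n+3}`, `P_{n+1}` are Mathlib's `cycleGraph (n + 3)`, `pathGraph (n + 3)`,
`pathGraph (n + 1)`), by Lemma 1.5 (edge deletion) at the closing edge `e = {0, n + 2}`:
`φ(C) = φ(C ∖ e) − φ(C ∖ {0, n+2}) − 2 φ_{0,n+2}(C ∖ e)` with `C ∖ e = P_{n+3}`,
`C ∖ {0, n+2} ≅ P_{n+1}` and `φ_{0,n+2}(P_{n+3}) = 1`.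
[cite: Godsil1993, Ch. 4 Ex. 5, held godsil2017 p. 64] -/
theorem charpoly_adjMatrix_cycleGraph (n : ℕ) [DecidableRel (pathGraph (n + 3)).Adj]
    [DecidableRel (pathGraph (n + 1)).Adj] :
    ((cycleGraph (n + 3)).adjMatrix R).charpoly =
      ((pathGraph (n + 3)).adjMatrix R).charpoly - ((pathGraph (n + 1)).adjMatrix R).charpoly - 2 := by
  obtain ⟨e⟩ := nonempty_iso_cycleGraph_induce n
  have hA : ((cycleGraph (n + 3)).deleteEdges {s((0 : Fin (n + 3)), Fin.last (n + 2))}).adjMatrix R =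
      (pathGraph (n + 3)).adjMatrix R := by
    ext a b
    simp only [adjMatrix_apply, cycleGraph_deleteEdges_eq_pathGraph]
  rw [charpoly_adjMatrix_eq_deleteEdges (cycleGraph (n + 3)) R (cycleGraph_adj_zero_last (n := n)),
    hA, ← charpoly_adjMatrix_iso e R, adjugate_charmatrix_pathGraph_zero_last, mul_one]

/-- **`φ(C_n, 2x) = 2 (T_n(x) − 1)`** — the Chebyshev form of Exercise 5, from
`φ(P_n, 2x) = U_n(x)` (Biggs 2b, `PendantVertexCharpoly.charpoly_adjMatrix_pathGraph_comp_two_mul_X`)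
and `U_n − U_{n−2} = 2 T_n`; so the eigenvalues of `C_n` are the `2 cos(2πk/n)`.
[cite: Godsil1993, Ch. 4 Ex. 5, held godsil2017 p. 64] -/
theorem charpoly_adjMatrix_cycleGraph_comp_two_mul_X (n : ℕ) :
    ((cycleGraph (n + 3)).adjMatrix R).charpoly.comp (2 * X) =
      2 * (Polynomial.Chebyshev.T R ((n + 3 : ℕ) : ℤ) - 1) := by
  classical
  rw [charpoly_adjMatrix_cycleGraph, sub_comp, sub_comp,
    charpoly_adjMatrix_pathGraph_comp_two_mul_X, charpoly_adjMatrix_pathGraph_comp_two_mul_X,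
    ofNat_comp]
  have h3 : ((n + 3 : ℕ) : ℤ) = ((n + 1 : ℕ) : ℤ) + 2 := by push_cast; ring
  rw [h3, Polynomial.Chebyshev.U_eq_two_mul_T_add_U]
  push_cast
  ring

/-- `φ(C_n, 2) = 0`: the valency `2` is an eigenvalue of the cycle (`T_n(1) = 1`).
[cite: Godsil1993, Ch. 4 Ex. 5, held godsil2017 p. 64] -/
theorem charpoly_adjMatrix_cycleGraph_eval_two (n : ℕ) :
    ((cycleGraph (n + 3)).adjMatrix R).charpoly.eval 2 = 0 := by
  have h := congrArg (Polynomial.eval (1 : R)) (charpoly_adjMatrix_cycleGraph_comp_two_mul_X R n)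
  simp only [eval_comp, eval_mul, eval_X, mul_one, eval_ofNat, eval_sub, eval_one,
    Polynomial.Chebyshev.T_eval_one, sub_self, mul_zero] at h
  exact h

/-- `φ(C_n, −2) = 2((−1)^n − 1)`: `−2` is an eigenvalue of `C_n` exactly when `n` is even
(`T_n(−1) = (−1)^n`). [cite: Godsil1993, Ch. 4 Ex. 5, held godsil2017 p. 64] -/
theorem charpoly_adjMatrix_cycleGraph_eval_neg_two (n : ℕ) :
    ((cycleGraph (n + 3)).adjMatrix R).charpoly.eval (-2) = 2 * ((-1) ^ (n + 3) - 1) := by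
  have h := congrArg (Polynomial.eval (-1 : R)) (charpoly_adjMatrix_cycleGraph_comp_two_mul_X R n)
  simp only [eval_comp, eval_mul, eval_X, mul_neg, mul_one, eval_ofNat, eval_sub, eval_one,
    Polynomial.Chebyshev.T_eval_neg_one, Int.cast_negOnePow_natCast] at h
  exact h

/-- `φ(C_3, x) = x³ − 3x − 2` (`C_3 = K_3`). [cite: Godsil1993, Ch. 4 Ex. 5, held godsil2017 p. 64] -/
theorem charpoly_adjMatrix_cycleGraph_three :
    ((cycleGraph 3).adjMatrix R).charpoly = X ^ 3 - 3 * X - 2 := by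
  classical
  refine (charpoly_adjMatrix_cycleGraph R 0).trans ?_
  rw [charpoly_adjMatrix_pathGraph_add_two R 1, charpoly_adjMatrix_pathGraph_add_two R 0,
    charpoly_adjMatrix_pathGraph_one, charpoly_adjMatrix_pathGraph_zero]
  ring

/-- `φ(C_4, x) = x⁴ − 4x²`. [cite: Godsil1993, Ch. 4 Ex. 5, held godsil2017 p. 64] -/
theorem charpoly_adjMatrix_cycleGraph_four :
    ((cycleGraph 4).adjMatrix R).charpoly = X ^ 4 - 4 * X ^ 2 := by
  classical
  refine (charpoly_adjMatrix_cycleGraph R 1).trans ?_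
  rw [charpoly_adjMatrix_pathGraph_add_two R 2, charpoly_adjMatrix_pathGraph_add_two R 1,
    charpoly_adjMatrix_pathGraph_add_two R 0, charpoly_adjMatrix_pathGraph_one,
    charpoly_adjMatrix_pathGraph_zero]
  ring

end Main

end Literature.Combinatorics.SimpleGraph.CycleGraphCharpoly
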